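import Summits.NavierStokesRegularity.NavierStokesRegularity.Theorems.SelfMixingDichotomyMixingPayoffAdvectionDiffusionMild
import Literature.Analysis.PDE.SemilinearHeatClassical
import HarnessLib

/-!
# Crux `MixingPayoff` (stmt-NavierStokesRegularity-1422), line `birth`, stub W2
  (`stub_advectionDiffusionSchwartz`): smooth short-time solutions of `∂ₜu = Δu + f(x, u, ∂u)`
  with an explicit existence time and quantitative by-products

Helper file (lands `--supports stmt-NavierStokesRegularity-1422`). The tree's
`Literature.Analysis.PDE.SemilinearHeat.exists_smooth_solution` (Taylor, *PDE III*, Ch. 15 §1;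
Lunardi 1995 §7.1) re-assembled from its ingredients (`mild_solution_explicit`,
`holder_bootstrap`, `contDiffOn_uncurry_Ico`, `hasDerivAt_slice`) so as to export, besides the
smooth solution on `[0, T) × E`, the explicit existence time, the sup bounds, the uniform `Cⁿ`
bounds of the slices, the joint continuity of the spatial derivatives, the mild formula and the
elementary properties of the data along the solution — the by-products needed to restart the
construction and to identify auxiliary components (stub W2 solves a linear equation with
time-dependent coefficients through the autonomous system for the pair `(ψ, clock)`).
-/

noncomputable section

open MeasureTheory Set Function Filter Metric Real
open _root_.Topology
open scoped ENNReal NNReal ContDiff Laplacian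

-- `Summit = Problem` for this summit; the tree lakefile sets `weak.linter.dupNamespace = false`.
set_option linter.dupNamespace false

namespace Summit.NavierStokesRegularity.NavierStokesRegularity.Theorems.SelfMixingDichotomy.MixingPayoffBirth

open Literature.Analysis.UnboundedOperators Literature.Analysis.UnboundedOperators.HeatHolder
open Literature.Analysis.FluidPDE Literature.Analysis.PDE.SemilinearHeat
open Literature.Analysis.Calculus (natCast_le_infty)

-- nested operator types `E →L[ℝ] E →L[ℝ] V`
set_option maxSynthPendingDepth 3

section SmoothStep

variable {E : Type} [NormedAddCommGroup E] [InnerProductSpace ℝ E] [FiniteDimensional ℝ E]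
  [MeasurableSpace E] [BorelSpace E]
variable {V : Type} [NormedAddCommGroup V] [NormedSpace ℝ V] [FiniteDimensional ℝ V]

set_option maxHeartbeats 800000 in
/-- **Smooth short-time solutions of `∂ₜu = Δu + f(x, u, ∂u)` from `C_b^∞` data, with an
explicit existence time and quantitative by-products** (the tree's
`SemilinearHeat.exists_smooth_solution`, Taylor *PDE III* Ch. 15 §1, re-assembled): for `f`
smooth with all derivatives of order `≤ n` bounded on `E × {‖w‖ ≤ R}` for every `n`, the
first-order bound on that set being `B₁`, and `u₀` smooth with every derivative bounded and
`‖u₀‖_{C¹} ≤ A₁`, `A₁ + 1 ≤ R`: with `T = (min (1/(4c(B₁+1))) (1/(2cB₁+1)))²` there is `u` on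
`[0, T)`, jointly `C^∞` on `[0, T) × E`, solving the equation on `(0, T)`, with `u(0) = u₀`,
`‖u‖, ‖∂u‖ ≤ R`, all slices bounded in every `Cⁿ` uniformly on `[0, T]`, all spatial
derivatives jointly continuous on `[0, T] × E`, and the mild formula on `(0, T]`. -/
theorem smooth_step (f : E × V × (E →L[ℝ] V) → V) (hf : ContDiff ℝ ∞ f)
    (hB : ∀ (n : ℕ) (R : ℝ), ∃ B, 0 ≤ B ∧ ∀ j ≤ n, ∀ (x : E) (w : V × (E →L[ℝ] V)), ‖w‖ ≤ R →
      ‖iteratedFDeriv ℝ j f (x, w)‖ ≤ B)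
    {R B₁ : ℝ} (hB₁0 : 0 ≤ B₁)
    (hB₁ : ∀ j ≤ 1, ∀ (x : E) (w : V × (E →L[ℝ] V)), ‖w‖ ≤ R → ‖iteratedFDeriv ℝ j f (x, w)‖ ≤ B₁)
    {T : ℝ} (hTdef : T = (min (1 / (4 * (2 : ℝ) ^ ((Module.finrank ℝ E : ℝ) / 2) * (B₁ + 1)))
      (1 / (2 * (2 : ℝ) ^ ((Module.finrank ℝ E : ℝ) / 2) * B₁ + 1))) ^ 2)
    (u₀ : E → V) (hu₀ : ∀ n, ∃ A, IsCkBounded n A u₀) {A₁ : ℝ} (hA₁ : IsCkBounded 1 A₁ u₀)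
    (hR : A₁ + 1 ≤ R) :
    0 < T ∧ T ≤ 1 ∧ ∃ u : ℝ → E → V, u 0 = u₀ ∧
      ContDiffOn ℝ ∞ (uncurry u) (Ico 0 T ×ˢ (univ : Set E)) ∧
      (∀ t ∈ Ioo 0 T, ∀ x,
        HasDerivAt (fun s => u s x) ((Δ (u t)) x + f (x, u t x, fderiv ℝ (u t) x)) t) ∧
      (∀ t x, ‖u t x‖ ≤ R ∧ ‖fderiv ℝ (u t) x‖ ≤ R) ∧
      (∀ n, ∃ A, ∀ t ∈ Icc 0 T, IsCkBounded n A (u t)) ∧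
      (∀ k, ContinuousOn (fun p : ℝ × E => iteratedFDeriv ℝ k (u p.1) p.2) (Icc 0 T ×ˢ univ)) ∧
      (∀ t ∈ Ioc 0 T, ∀ x, u t x = heatExtension u₀ t x +
        ∫ s in Ioo 0 t, heatExtension (fun y => f (y, u s y, fderiv ℝ (u s) y)) (t - s) x) ∧
      (StronglyMeasurable (uncurry fun s y => f (y, u s y, fderiv ℝ (u s) y)) ∧
        (∀ s, Continuous fun y => f (y, u s y, fderiv ℝ (u s) y)) ∧
        ∀ s y, ‖f (y, u s y, fderiv ℝ (u s) y)‖ ≤ B₁) := by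
  classical
  haveI : CompleteSpace V := FiniteDimensional.complete ℝ V
  -- ### the constants for the contraction
  have hfM : ∀ (x : E) (w : V × (E →L[ℝ] V)), ‖w‖ ≤ R → ‖f (x, w)‖ ≤ B₁ := fun x w hw => by
    have := hB₁ 0 (Nat.zero_le _) x w hw; rwa [norm_iteratedFDeriv_zero] at this
  have hfL : ∀ (x : E) (w w' : V × (E →L[ℝ] V)), ‖w‖ ≤ R → ‖w'‖ ≤ R →
      ‖f (x, w) - f (x, w')‖ ≤ B₁ * ‖w - w'‖ := by
    intro x w w' hw hw'
    have hd : ∀ z ∈ closedBall (0 : V × (E →L[ℝ] V)) R, DifferentiableAt ℝ (fun z => f (x, z)) z :=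
      fun z _ => (hf.differentiable (by simp) (x, z)).comp z
        ((differentiableAt_const x).prodMk differentiableAt_id)
    have hbd : ∀ z ∈ closedBall (0 : V × (E →L[ℝ] V)) R, ‖fderiv ℝ (fun z => f (x, z)) z‖ ≤ B₁ := by
      intro z hz
      have hz' : ‖z‖ ≤ R := mem_closedBall_zero_iff.1 hz
      have hcomp : fderiv ℝ (fun z => f (x, z)) z =
          (fderiv ℝ f (x, z)).comp (ContinuousLinearMap.inr ℝ E (V × (E →L[ℝ] V))) := by
        have h1 : HasFDerivAt (fun z : V × (E →L[ℝ] V) => ((x, z) : E × V × (E →L[ℝ] V)))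
            (ContinuousLinearMap.inr ℝ E (V × (E →L[ℝ] V))) z :=
          (hasFDerivAt_const x z).prodMk (hasFDerivAt_id z) |>.congr_fderiv (by ext <;> simp)
        exact ((hf.differentiable (by simp) (x, z)).hasFDerivAt.comp z h1).fderiv
      rw [hcomp]
      calc _ ≤ ‖fderiv ℝ f (x, z)‖ * ‖ContinuousLinearMap.inr ℝ E (V × (E →L[ℝ] V))‖ :=
            ContinuousLinearMap.opNorm_comp_le _ _
        _ ≤ B₁ * 1 := by
            refine mul_le_mul ?_ (ContinuousLinearMap.norm_inr_le_one ℝ E _) (norm_nonneg _) hB₁0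
            have := hB₁ 1 le_rfl x z hz'; rwa [norm_iteratedFDeriv_one] at this
        _ = B₁ := mul_one _
    exact (convex_closedBall (0 : V × (E →L[ℝ] V)) R).norm_image_sub_le_of_norm_fderiv_le hd hbd
      (mem_closedBall_zero_iff.2 hw') (mem_closedBall_zero_iff.2 hw)
  -- ### the mild solution
  obtain ⟨hT, hT1, u, hu0, huout, hu1, huR, hum, hDum, hmild⟩ :=
    mild_solution_explicit f hf.continuous hA₁ hR hB₁0 hB₁0 hfM hfL hTdef
  -- ### spatial regularity
  have hboot := holder_bootstrap hf hB hu₀ hT1 hu1 huR hum hDum hmild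
  have hslices : ∀ n, ∃ A, ∀ t ∈ Ioc 0 T, IsCkBounded n A (u t) := fun n => by
    obtain ⟨M, hM⟩ := hboot n
    exact ⟨M, fun t ht => (hM t ht).isCkBounded.of_succ⟩
  -- the data extended by zero off `(0, T]`
  set gt : ℝ → E → V := fun s => if s ∈ Ioc 0 T then (fun y => f (y, u s y, fderiv ℝ (u s) y)) else 0
    with hgt
  have hgt_in : ∀ {s}, s ∈ Ioc 0 T → gt s = fun y => f (y, u s y, fderiv ℝ (u s) y) := fun hs => by
    simp only [hgt, hs, if_true]
  have hgt_out : ∀ {s}, s ∉ Ioc 0 T → gt s = 0 := fun hs => by simp only [hgt, hs, if_false]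
  obtain ⟨hgm, hgc, hgM⟩ := data_basic hf.continuous hfM hu1 huR hum hDum
  have hgtm : StronglyMeasurable (uncurry gt) := by
    have hfun : uncurry gt = {p : ℝ × E | p.1 ∈ Ioc 0 T}.piecewise
        (uncurry fun s y => f (y, u s y, fderiv ℝ (u s) y)) 0 := by
      funext p
      by_cases hp : p.1 ∈ Ioc 0 T
      · rw [Set.piecewise_eq_of_mem _ _ _ (show p ∈ {p : ℝ × E | p.1 ∈ Ioc 0 T} from hp)]
        simp only [uncurry, hgt, hp, if_true]
      · rw [Set.piecewise_eq_of_notMem _ _ _ (show p ∉ {p : ℝ × E | p.1 ∈ Ioc 0 T} from hp)]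
        simp only [uncurry, hgt, hp, if_false, Pi.zero_apply]
    rw [hfun]
    exact hgm.piecewise (measurable_fst measurableSet_Ioc) stronglyMeasurable_const
  have hgtb : ∀ n, ∃ G, ∀ s, IsCkBounded n G (gt s) := fun n => by
    obtain ⟨M, hM⟩ := hboot n
    obtain ⟨G, hG0, hGd⟩ := data_holder_of_slices hf hB huR hM
    refine ⟨G, fun s => ?_⟩
    by_cases hs : s ∈ Ioc 0 T
    · rw [hgt_in hs]; exact (hGd s hs).isCkBounded
    · rw [hgt_out hs]; exact ((isHolderField_zero n (1 / 2)).mono_const hG0).isCkBounded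
  have hrep : ∀ t ∈ Ioc 0 T, u t = heatExtension u₀ t +
      fun x => ∫ s in Ioo 0 t, heatExtension (gt s) (t - s) x := by
    intro t ht
    funext x
    rw [Pi.add_apply, hmild t ht x]
    congr 1
    refine setIntegral_congr_fun measurableSet_Ioo fun s hs => ?_
    rw [hgt_in ⟨hs.1, hs.2.le.trans ht.2⟩]
  have hgt_eq : ∀ t ∈ Ioc 0 T, gt t = fun y => f (y, u t y, fderiv ℝ (u t) y) := fun t ht => hgt_in ht
  -- smooth slices
  have hu₀s : ContDiff ℝ ∞ u₀ := contDiff_infty.2 fun n => by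
    obtain ⟨A, hA⟩ := hu₀ n; exact hA.contDiff
  have hsm : ∀ t, ContDiff ℝ ∞ (u t) := fun t => by
    by_cases ht : t ∈ Ioc 0 T
    · exact contDiff_infty.2 fun n => by
        obtain ⟨A, hA⟩ := hslices n; exact (hA t ht).contDiff
    · rw [huout t ht]; exact hu₀s
  -- ### time regularity: joint continuity of all spatial derivatives on `[0, T] × E`
  have hcont : ∀ k, ContinuousOn (fun p : ℝ × E => iteratedFDeriv ℝ k (u p.1) p.2) (Icc 0 T ×ˢ univ) := by
    intro k
    obtain ⟨A, hA⟩ := hu₀ (k + 2)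
    obtain ⟨G, hG⟩ := hgtb (k + 2)
    exact continuousOn_iteratedFDeriv_slice
      (fun t _ => (hsm t).of_le (mod_cast (le_top : ((k : ℕ) : ℕ∞) ≤ ⊤)))
      fun s t hs hst htT x => norm_iteratedFDeriv_slice_sub_le hT1 hA hgtm hG hu0 hrep hs hst htT x
  -- slices bounded in every `Cⁿ` on the closed interval
  have hslices' : ∀ n, ∃ A, ∀ t ∈ Icc 0 T, IsCkBounded n A (u t) := fun n => by
    obtain ⟨A, hA⟩ := hslices n
    obtain ⟨A', hA'⟩ := hu₀ n
    refine ⟨max A A', fun t ht => ?_⟩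
    by_cases ht0 : t ∈ Ioc 0 T
    · exact ⟨(hA t ht0).contDiff, fun j hj x => ((hA t ht0).norm_le j hj x).trans (le_max_left _ _)⟩
    · have ht' : t = 0 := by
        by_contra h
        exact ht0 ⟨lt_of_le_of_ne ht.1 (Ne.symm h), ht.2⟩
      subst ht'
      rw [hu0]
      exact ⟨hA'.contDiff, fun j hj x => (hA'.norm_le j hj x).trans (le_max_right _ _)⟩
  -- ### conclusion
  refine ⟨hT, hT1, u, hu0, ?_, fun t ht x => ?_, huR, hslices', hcont, hmild, hgm, hgc, hgM⟩
  · exact contDiffOn_uncurry_Ico hf hu₀ hgtm hgtb hT hT1 hsm hslices hcont hrep hgt_eq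
  · exact hasDerivAt_slice hf hu₀ hgtm hgtb hT1 hsm hcont hrep hgt_eq ht x

end SmoothStep

/-- Anchor (registered sub-stub of stub W2): the existence time of `smooth_step` is positive and
at most one (closed form of the first two conclusions, for the record). -/
theorem w2aux_smoothStepTime : ∀ (c B₁ : ℝ), 1 ≤ c → 0 ≤ B₁ →
    0 < (min (1 / (4 * c * (B₁ + 1))) (1 / (2 * c * B₁ + 1))) ^ 2 ∧
    (min (1 / (4 * c * (B₁ + 1))) (1 / (2 * c * B₁ + 1))) ^ 2 ≤ 1 := by
  intro c B₁ hc hB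
  obtain ⟨h0, h1, -⟩ := smallness_constants hc hB hB rfl
  exact ⟨by positivity, by nlinarith⟩

end Summit.NavierStokesRegularity.NavierStokesRegularity.Theorems.SelfMixingDichotomy.MixingPayoffBirth

end
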